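import Literature.MathematicalPhysics.QuantumFieldTheory.Balaban1983to89.B13

/-!
# BalabanUVNodes ∕ node N22 = NE9 — THE BOX BLOCK OF THE s1 RECORD AT PRINT'S CHARACTERISTIC FUNCTIONS READ IN THE UNSCALED FIELD
# (the located inputs `hχ0 hχc0 hχm hχcm hχe hχce h222 hqP hχ1 hboxR hbox` of `YMDAG.N22.W1.SliceInputsL2U` DISCHARGED for
# `χᵘ(A) = Π_{b∈Y₀} χ(|A(b)| < ε₁)`, `χᶜᵘ(A) = Π_{b∈P} χ(|A(b)| ≥ ε₁)` — [I] (2.9), [II] (2.3), (2.22))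

Cell `pub-ymgap`, HUMAN RULING D-0062 (Track A) ∕ D-0149 (width seats), seat `pub-ymgap-dag-n22-w1` (WIDTH SEAT 1 of 3 on node n22), generation 0.
THEOREMS ONLY (0 `def`, 0 `structure`, 0 `instance`, 0 `sorry`); imports `Literature/…/B13` (for the certified scalar (2.22) device
`B13.indicator_le_exp_222`) and through it Mathlib; restates nothing.  `--kind proof --supports stmt-QuantumFields-20544 --as helper` (K3⁷
`SpineGivenEndpointR13SepCoPH`).  Plan g77 W-SEAT-START-LIST § n22 item 1 «`N22At R.u3` at the record»: its memory half is the tree's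
`YMDAG.UVSplit.fadingMemory_u3OfRecord₁₃` (letter-sign face, nothing to file); this file serves its Lipschitz half (NE9 at the W1 reading of record)
through the located-input record of seat dag-n22-c's end-state knit.

WHY.  dag-n22-c's knit `YMDAG.N22.W1.n22At_u3OfRecord₁₃_ofRecordAdm_runTowers_toClusterTower_of_n18Below_unscaledLawDatumL2U` (module J17-K, p579841)
concludes `N22At` at the admissible W1 reading of record from ONE located-input record `YMDAG.N22.W1.SliceInputsL2U …` per slice (module J17-D, p578863).
Among that record's fields is the BOX BLOCK — the properties of the two characteristic functions `χᵘ`, `χᶜᵘ` of the (2.14) term read in the UNSCALED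
fluctuation field at the base point `s₀` (node00-def-W1 W1-11 `TermDatum214.UnscaledFieldLawOn`: `χ_{k,Y₀}(s, B) = χᵘ(s·B)`, `χᶜ_{k,P}(s, B) = χᶜᵘ(s·B)`):
signs `hχ0 hχc0`, measurability `hχm hχcm`, evenness `hχe hχce`, the large-field estimate (2.22) `h222` with its quadratic letter `hqP`, `hχ1`, the box law
`hboxR` and the s-free box-support law `hbox`.  The n22-c lane lists this block as a PRODUCER's («boxes at s₀ with (2.22), box laws — N09»; HANDOFF g9∕g10);
the in-tree inhabitants of the record (modules J12-W∕Wb, J13, J17-W) take TRIVIAL boxes `χᵘ = χᶜᵘ ≡ 1`, `S₀ = ∅`.  THIS FILE discharges the block at PRINT'S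
boxes: [I] (2.9) p. 266 «χ_k = Π χ({|B′(b)| < ε₁})» (a product of bond indicators in the unscaled field), [II] (2.3) p. 12 «χᶜ_{k,P} = Π_{b∈P} χ({|B(b)| ≥ ε₁∕g_k})»
(after [I]'s scaling `B = g_kB′`), and (2.22) p. 16 «χ_{k,Y₀}(B)χᶜ_{k,P}(B) ≤ exp(−½γ₂(ε₁²∕g_k²)|P| + ½γ₂‖PB‖²), where γ₂ is a small, positive constant» — whose
proof is the per-bond Chebyshev step certified in the tree as `B13.indicator_le_exp_222`.  These are node00-def-B13's DISPLAY SHAPES `ResidB13K.chiY₀ ∕ chicP`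
(`Node00/CarriersB13KernelTower`, threshold `rP = ε₁∕‖g‖`) read unscaled: `χᵘ(s₀·B) = Π χ(|B(b)| < ε₁∕s₀)` (§4 below).

WHAT (over an ABSTRACT bond type `Λ`; the boxes in HYPOTHESIS FORM `hχu : ∀ A, χu A = ∏ b ∈ Y₀, χ(|A b| < ε)`, `hχcu : ∀ A, χcu A = ∏ b ∈ P, χ(ε ≤ |A b|)` — the
tree's pattern `B12Eq213GaussianSmallFieldMass` — so that a consumer instantiates at `(𝔇.𝒦 Z t).Λ`, node00-def-B13's row-bond sets `Y0l Z t`, `Pl Z t` and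
its threshold by `rfl`; nothing is defined here):
* §1 one bond read at `s₀ • B`: `boxFactor_smul`, `largeFactor_smul` (threshold `ε` on `s₀·B` = threshold `ε∕s₀` on `B`).
* §2 indicator products: `prodBox_nonneg ∕ _le_one ∕ _eq_one_iff ∕ _eq_zero_or_one`, `prodLarge_nonneg ∕ _le_one ∕ _eq_one_iff ∕ _eq_zero_or_one`,
  `prodLarge_le_exp_sum` (the product form of `B13.indicator_le_exp_222`).
* §3 THE J17-D BINDERS AT PRINT'S BOXES, in their shapes: `chi_smul_nonneg ∕ chic_smul_nonneg` (hχ0 ∕ hχc0), `measurable_chi_smul ∕ measurable_chic_smul`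
  (hχm ∕ hχcm), `chi_smul_neg ∕ chic_smul_neg` (hχe ∕ hχce), and the s-FREE faces `chi_neg ∕ chic_neg ∕ measurable_chi ∕ measurable_chic` (node00-def-W1 W1-12
  `TermDatum214.UnscaledBoxLaws` field shapes), `sum_sq_le_dotProduct` (hqP for `qP B := Σ_{b∈P} B(b)²`), ★ `chi_mul_chic_le_exp_222` (h222, for every
  threshold letter `0 ≤ rP`, `rP·s₀ ≤ ε` — print's `rP = ε₁∕s₀` — and every `n ≤ |P|` in the exponent; node00-def-B13's `|Pl| = |P|` stays its pin) with the
  print instance `chi_mul_chic_le_exp_222_print`, `chi_mul_chic_le_one` (hχ1, unconditionally), ★ `chi_mul_chic_eq_one_of_dotProduct_lt` (hboxR: no large-field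
  bonds and `⟨B,B⟩ < Rb²`, `Rb·s₀ ≤ ε` ⇒ `χᵘχᶜᵘ = 1`), `chi_ne_zero_support ∕ chi_ne_zero_support_le` (hbox with `S₀ := ↑Y₀`, any `ρ ≥ ε`).
* §4 the junction with node00-def-B13's display: `chi_smul_eq_prod_threshold ∕ chic_smul_eq_prod_threshold`.
* §5 the box-tail letters UNIFORM IN THE BASE POINT at print's thresholds `Rb = rP = ε∕s₀`: `exp_neg_div_sq_le` (`e^{−c∕s²} ≤ s²∕(e·c)`),
  `boxTail_le_uniform` (hRb with ONE `T := (e·½κε²)⁻¹` for all `s₀ > 0`), `surplusTail_le_uniform` (hTP with ONE `TP := e^{½γ₂r₁²}(e·½γ₂ε²)⁻¹`) — the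
  `s₀²`-gain of [I] p. 268 «the expression under the exponential vanishes at g_k = 0», so that the slices' tail letters are window-uniform.

HONEST FRAMING — what this is NOT.  Elementary indicator algebra and the Chebyshev step print uses for (2.22); count-neutral; NOT a discharge of N22 (typed 28∕28 ·
discharged 5∕27 UNCHANGED; the chair's count line is the only count).  NOTHING of Bałaban's construction is asserted: WHICH bonds form `Y₀` and `P`, the
threshold `ε₁` and base point `s₀` of record, and the identification of the datum's opaque `chiY₀ ∕ chicP` with print's boxes (W1-11's law at node00-def-B13's
display) remain the definers' pins; the other blocks of the record (kernel letters, potentials, Lemma 2's sentence, closures, numerals) are untouched.  One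
finite four-torus programme at fixed ε — R4 closes the conditional rung `BalabanLadder.UV` only; NOT the continuum limit, NOT OS, NOT a mass gap, NOT Clay.
0 `sorry`, standard axioms.

References (TYPES ∕ loci only): [I] = [Balaban1987RG1] T. Bałaban, CMP **109** (1987), (2.9) p. 266, (2.12) p. 268 («B = g_kB′»); [II] = [Balaban1988RG2Cluster]
T. Bałaban, CMP **116** (1988), (2.2)–(2.3) p. 12, (2.22) p. 16.
-/

namespace Summit.QuantumFields.YangMills.BalabanUVNodes.N22PrintedBoxBlock

open scoped BigOperators
open Matrix
open Literature.MathematicalPhysics.QuantumFieldTheory.Balaban1983to89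

variable {Λ : Type*}

/-! ## §1 One bond read at the dilated field `s₀ • B` -/

/-- The small-field bond indicator at threshold `ε` read at `s • B` is the indicator at threshold `ε ∕ s` read at `B` (`s > 0`): [I]'s scaling `B = g_kB′`
turning `|B′(b)| < ε₁` into `|B(b)| < ε₁∕g_k`. [cite: Balaban1987RG1, (2.9) p.266 and (2.12) p.268] -/
theorem boxFactor_smul {s ε : ℝ} (hs : 0 < s) (B : Λ → ℝ) (b : Λ) :
    (if |(s • B) b| < ε then (1 : ℝ) else 0) = if |B b| < ε / s then (1 : ℝ) else 0 := by
  have h : |(s • B) b| < ε ↔ |B b| < ε / s := by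
    rw [Pi.smul_apply, smul_eq_mul, abs_mul, abs_of_pos hs, lt_div_iff₀ hs, mul_comm]
  simp only [h]

/-- The large-field bond indicator at threshold `ε` read at `s • B` is the indicator at threshold `ε ∕ s` read at `B` (`s > 0`) — (2.3)'s
`χ({|B(b)| ≥ ε₁∕g_k})`. [cite: Balaban1988RG2Cluster, (2.3) p.12] -/
theorem largeFactor_smul {s ε : ℝ} (hs : 0 < s) (B : Λ → ℝ) (b : Λ) :
    (if ε ≤ |(s • B) b| then (1 : ℝ) else 0) = if ε / s ≤ |B b| then (1 : ℝ) else 0 := by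
  have h : ε ≤ |(s • B) b| ↔ ε / s ≤ |B b| := by
    rw [Pi.smul_apply, smul_eq_mul, abs_mul, abs_of_pos hs, div_le_iff₀ hs, mul_comm]
  simp only [h]

/-! ## §2 Indicator products -/

/-- A product of small-field bond indicators is nonnegative. [folklore] -/
theorem prodBox_nonneg (S : Finset Λ) (ε : ℝ) (A : Λ → ℝ) : 0 ≤ ∏ b ∈ S, (if |A b| < ε then (1 : ℝ) else 0) :=
  Finset.prod_nonneg fun b _ => by split_ifs <;> norm_num

/-- A product of small-field bond indicators is at most one. [folklore] -/
theorem prodBox_le_one (S : Finset Λ) (ε : ℝ) (A : Λ → ℝ) : ∏ b ∈ S, (if |A b| < ε then (1 : ℝ) else 0) ≤ 1 :=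
  Finset.prod_le_one (fun b _ => by split_ifs <;> norm_num) fun b _ => by split_ifs <;> norm_num

/-- A product of small-field bond indicators equals one iff every bond of the support is small. [folklore] -/
theorem prodBox_eq_one_iff (S : Finset Λ) (ε : ℝ) (A : Λ → ℝ) :
    ∏ b ∈ S, (if |A b| < ε then (1 : ℝ) else 0) = 1 ↔ ∀ b ∈ S, |A b| < ε := by
  constructor
  · intro h b hb
    by_contra hlt
    have h0 : ∏ b ∈ S, (if |A b| < ε then (1 : ℝ) else 0) = 0 := Finset.prod_eq_zero hb (if_neg hlt)
    rw [h0] at h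
    exact zero_ne_one h
  · intro h
    exact Finset.prod_eq_one fun b hb => if_pos (h b hb)

/-- A product of small-field bond indicators is `0` or `1`. [folklore] -/
theorem prodBox_eq_zero_or_one (S : Finset Λ) (ε : ℝ) (A : Λ → ℝ) :
    ∏ b ∈ S, (if |A b| < ε then (1 : ℝ) else 0) = 0 ∨ ∏ b ∈ S, (if |A b| < ε then (1 : ℝ) else 0) = 1 := by
  by_cases h : ∀ b ∈ S, |A b| < ε
  · exact Or.inr ((prodBox_eq_one_iff S ε A).2 h)
  · push Not at h
    obtain ⟨b, hb, hle⟩ := h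
    exact Or.inl (Finset.prod_eq_zero hb (if_neg (not_lt.2 hle)))

/-- A product of large-field bond indicators is nonnegative. [folklore] -/
theorem prodLarge_nonneg (P : Finset Λ) (ε : ℝ) (A : Λ → ℝ) : 0 ≤ ∏ b ∈ P, (if ε ≤ |A b| then (1 : ℝ) else 0) :=
  Finset.prod_nonneg fun b _ => by split_ifs <;> norm_num

/-- A product of large-field bond indicators is at most one. [folklore] -/
theorem prodLarge_le_one (P : Finset Λ) (ε : ℝ) (A : Λ → ℝ) : ∏ b ∈ P, (if ε ≤ |A b| then (1 : ℝ) else 0) ≤ 1 :=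
  Finset.prod_le_one (fun b _ => by split_ifs <;> norm_num) fun b _ => by split_ifs <;> norm_num

/-- A product of large-field bond indicators equals one iff every bond of `P` is large. [folklore] -/
theorem prodLarge_eq_one_iff (P : Finset Λ) (ε : ℝ) (A : Λ → ℝ) :
    ∏ b ∈ P, (if ε ≤ |A b| then (1 : ℝ) else 0) = 1 ↔ ∀ b ∈ P, ε ≤ |A b| := by
  constructor
  · intro h b hb
    by_contra hlt
    have h0 : ∏ b ∈ P, (if ε ≤ |A b| then (1 : ℝ) else 0) = 0 := Finset.prod_eq_zero hb (if_neg hlt)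
    rw [h0] at h
    exact zero_ne_one h
  · intro h
    exact Finset.prod_eq_one fun b hb => if_pos (h b hb)

/-- A product of large-field bond indicators is `0` or `1`. [folklore] -/
theorem prodLarge_eq_zero_or_one (P : Finset Λ) (ε : ℝ) (A : Λ → ℝ) :
    ∏ b ∈ P, (if ε ≤ |A b| then (1 : ℝ) else 0) = 0 ∨ ∏ b ∈ P, (if ε ≤ |A b| then (1 : ℝ) else 0) = 1 := by
  by_cases h : ∀ b ∈ P, ε ≤ |A b|
  · exact Or.inr ((prodLarge_eq_one_iff P ε A).2 h)
  · push Not at h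
    obtain ⟨b, hb, hlt⟩ := h
    exact Or.inl (Finset.prod_eq_zero hb (if_neg (not_le.2 hlt)))

/-- **(2.22), PRODUCT FORM** of the tree's per-bond Chebyshev device `B13.indicator_le_exp_222`: for `γ₂ ≥ 0`, `r ≥ 0`,
`Π_{b∈P} χ(|A(b)| ≥ r) ≤ exp(½γ₂ Σ_{b∈P} A(b)² − ½γ₂ r²|P|)`. [cite: Balaban1988RG2Cluster, (2.22) p.16] -/
theorem prodLarge_le_exp_sum (P : Finset Λ) {r γ₂ : ℝ} (hγ : 0 ≤ γ₂) (hr : 0 ≤ r) (A : Λ → ℝ) :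
    ∏ b ∈ P, (if r ≤ |A b| then (1 : ℝ) else 0) ≤
      Real.exp (γ₂ / 2 * ∑ b ∈ P, A b ^ 2 - γ₂ / 2 * r ^ 2 * (P.card : ℝ)) := by
  have hstep : ∏ b ∈ P, (if r ≤ |A b| then (1 : ℝ) else 0) ≤ ∏ b ∈ P, Real.exp (γ₂ / 2 * (A b ^ 2 - r ^ 2)) :=
    Finset.prod_le_prod (fun b _ => by split_ifs <;> norm_num) fun b _ => B13.indicator_le_exp_222 (A b) r γ₂ hγ hr
  have hsum : ∑ b ∈ P, γ₂ / 2 * (A b ^ 2 - r ^ 2) = γ₂ / 2 * ∑ b ∈ P, A b ^ 2 - γ₂ / 2 * r ^ 2 * (P.card : ℝ) := by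
    have h1 : ∑ b ∈ P, γ₂ / 2 * (A b ^ 2 - r ^ 2) = ∑ b ∈ P, (γ₂ / 2 * A b ^ 2 - γ₂ / 2 * r ^ 2) :=
      Finset.sum_congr rfl fun b _ => by ring
    rw [h1, Finset.sum_sub_distrib, Finset.sum_const, nsmul_eq_mul, ← Finset.mul_sum]
    ring
  rw [← hsum, Real.exp_sum]
  exact hstep

/-- A6 (hypotheses satisfiable): the hypothesis form `hχu ∕ hχcu` of §3 is inhabited by print's boxes themselves (`rfl`). [folklore] -/
theorem printedBoxes_inhabited (Y₀ P : Finset Λ) (ε : ℝ) : ∃ χu χcu : (Λ → ℝ) → ℝ,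
    (∀ A, χu A = ∏ b ∈ Y₀, (if |A b| < ε then (1 : ℝ) else 0)) ∧ ∀ A, χcu A = ∏ b ∈ P, (if ε ≤ |A b| then (1 : ℝ) else 0) :=
  ⟨_, _, fun _ => rfl, fun _ => rfl⟩

/-! ## §3 The box block of `YMDAG.N22.W1.SliceInputsL2U` at print's boxes -/

section Block

variable (χu χcu : (Λ → ℝ) → ℝ) (Y₀ P : Finset Λ) (ε : ℝ)

/-- `hχ0` at print's boxes: `0 ≤ χᵘ(s₀·B)`. [cite: Balaban1987RG1, (2.9) p.266] -/
theorem chi_smul_nonneg (hχu : ∀ A, χu A = ∏ b ∈ Y₀, (if |A b| < ε then (1 : ℝ) else 0)) (s₀ : ℝ) (B : Λ → ℝ) :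
    0 ≤ χu (s₀ • B) := by
  rw [hχu]
  exact prodBox_nonneg Y₀ ε _

/-- `hχc0` at print's boxes: `0 ≤ χᶜᵘ(s₀·B)`. [cite: Balaban1988RG2Cluster, (2.3) p.12] -/
theorem chic_smul_nonneg (hχcu : ∀ A, χcu A = ∏ b ∈ P, (if ε ≤ |A b| then (1 : ℝ) else 0)) (s₀ : ℝ) (B : Λ → ℝ) :
    0 ≤ χcu (s₀ • B) := by
  rw [hχcu]
  exact prodLarge_nonneg P ε _

/-- `hχe` at print's boxes: the small-field box is EVEN, `χᵘ(s₀·(−B)) = χᵘ(s₀·B)`. [cite: Balaban1987RG1, (2.9) p.266] -/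
theorem chi_smul_neg (hχu : ∀ A, χu A = ∏ b ∈ Y₀, (if |A b| < ε then (1 : ℝ) else 0)) (s₀ : ℝ) (B : Λ → ℝ) :
    χu (s₀ • (-B)) = χu (s₀ • B) := by
  rw [hχu, hχu]
  refine Finset.prod_congr rfl fun b _ => ?_
  simp only [Pi.smul_apply, Pi.neg_apply, smul_eq_mul, mul_neg, abs_neg]

/-- `hχce` at print's boxes: the large-field function is EVEN, `χᶜᵘ(s₀·(−B)) = χᶜᵘ(s₀·B)`. [cite: Balaban1988RG2Cluster, (2.3) p.12] -/
theorem chic_smul_neg (hχcu : ∀ A, χcu A = ∏ b ∈ P, (if ε ≤ |A b| then (1 : ℝ) else 0)) (s₀ : ℝ) (B : Λ → ℝ) :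
    χcu (s₀ • (-B)) = χcu (s₀ • B) := by
  rw [hχcu, hχcu]
  refine Finset.prod_congr rfl fun b _ => ?_
  simp only [Pi.smul_apply, Pi.neg_apply, smul_eq_mul, mul_neg, abs_neg]

/-- The s-FREE parity of print's small-field box (node00-def-W1 W1-12 `UnscaledBoxLaws.hχe` shape): `χᵘ(−A) = χᵘ(A)`. [cite: Balaban1987RG1, (2.9) p.266] -/
theorem chi_neg (hχu : ∀ A, χu A = ∏ b ∈ Y₀, (if |A b| < ε then (1 : ℝ) else 0)) (A : Λ → ℝ) : χu (-A) = χu A := by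
  rw [hχu, hχu]
  exact Finset.prod_congr rfl fun b _ => by simp only [Pi.neg_apply, abs_neg]

/-- The s-FREE parity of print's large-field function (W1-12 `UnscaledBoxLaws.hχce` shape): `χᶜᵘ(−A) = χᶜᵘ(A)`. [cite: Balaban1988RG2Cluster, (2.3) p.12] -/
theorem chic_neg (hχcu : ∀ A, χcu A = ∏ b ∈ P, (if ε ≤ |A b| then (1 : ℝ) else 0)) (A : Λ → ℝ) : χcu (-A) = χcu A := by
  rw [hχcu, hχcu]
  exact Finset.prod_congr rfl fun b _ => by simp only [Pi.neg_apply, abs_neg]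

/-- The s-FREE measurability of print's small-field box (W1-12 `UnscaledBoxLaws.hχm` shape). [folklore] -/
theorem measurable_chi (hχu : ∀ A, χu A = ∏ b ∈ Y₀, (if |A b| < ε then (1 : ℝ) else 0)) : Measurable χu := by
  have hfun : χu = fun A => ∏ b ∈ Y₀, (if |A b| < ε then (1 : ℝ) else 0) := funext hχu
  rw [hfun]
  refine Finset.measurable_prod Y₀ fun b _ => ?_
  have hm : Measurable fun A : Λ → ℝ => |A b| := by fun_prop
  exact Measurable.ite (measurableSet_lt hm measurable_const) measurable_const measurable_const

/-- The s-FREE measurability of print's large-field function (W1-12 `UnscaledBoxLaws.hχcm` shape). [folklore] -/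
theorem measurable_chic (hχcu : ∀ A, χcu A = ∏ b ∈ P, (if ε ≤ |A b| then (1 : ℝ) else 0)) : Measurable χcu := by
  have hfun : χcu = fun A => ∏ b ∈ P, (if ε ≤ |A b| then (1 : ℝ) else 0) := funext hχcu
  rw [hfun]
  refine Finset.measurable_prod P fun b _ => ?_
  have hm : Measurable fun A : Λ → ℝ => |A b| := by fun_prop
  exact Measurable.ite (measurableSet_le measurable_const hm) measurable_const measurable_const

/-- `hχm` at print's boxes: `B ↦ χᵘ(s₀·B)` is measurable (a finite product of indicators of measurable slabs). [folklore] -/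
theorem measurable_chi_smul (hχu : ∀ A, χu A = ∏ b ∈ Y₀, (if |A b| < ε then (1 : ℝ) else 0)) (s₀ : ℝ) :
    Measurable fun B : Λ → ℝ => χu (s₀ • B) := by
  have hfun : (fun B : Λ → ℝ => χu (s₀ • B)) = fun B => ∏ b ∈ Y₀, (if |(s₀ • B) b| < ε then (1 : ℝ) else 0) :=
    funext fun B => hχu _
  rw [hfun]
  refine Finset.measurable_prod Y₀ fun b _ => ?_
  have hm : Measurable fun B : Λ → ℝ => |(s₀ • B) b| := by
    have h : (fun B : Λ → ℝ => |(s₀ • B) b|) = fun B => |s₀ * B b| := funext fun B => rfl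
    rw [h]
    fun_prop
  exact Measurable.ite (measurableSet_lt hm measurable_const) measurable_const measurable_const

/-- `hχcm` at print's boxes: `B ↦ χᶜᵘ(s₀·B)` is measurable. [folklore] -/
theorem measurable_chic_smul (hχcu : ∀ A, χcu A = ∏ b ∈ P, (if ε ≤ |A b| then (1 : ℝ) else 0)) (s₀ : ℝ) :
    Measurable fun B : Λ → ℝ => χcu (s₀ • B) := by
  have hfun : (fun B : Λ → ℝ => χcu (s₀ • B)) = fun B => ∏ b ∈ P, (if ε ≤ |(s₀ • B) b| then (1 : ℝ) else 0) :=
    funext fun B => hχcu _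
  rw [hfun]
  refine Finset.measurable_prod P fun b _ => ?_
  have hm : Measurable fun B : Λ → ℝ => |(s₀ • B) b| := by
    have h : (fun B : Λ → ℝ => |(s₀ • B) b|) = fun B => |s₀ * B b| := funext fun B => rfl
    rw [h]
    fun_prop
  exact Measurable.ite (measurableSet_le measurable_const hm) measurable_const measurable_const

/-- `hqP` at print's quadratic letter `q_P(B) := Σ_{b∈P} B(b)²` («‖PB‖²» of (2.22)): `q_P(B) ≤ ⟨B, B⟩`. [cite: Balaban1988RG2Cluster, (2.22) p.16] -/
theorem sum_sq_le_dotProduct [Fintype Λ] (B : Λ → ℝ) : ∑ b ∈ P, B b ^ 2 ≤ B ⬝ᵥ B := by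
  calc ∑ b ∈ P, B b ^ 2 ≤ ∑ b, B b ^ 2 := Finset.sum_le_univ_sum_of_nonneg fun b => sq_nonneg (B b)
    _ = B ⬝ᵥ B := by simp only [dotProduct, sq]

/-- ★ **`h222` AT PRINT'S BOXES — (2.22) p. 16** «χ_{k,Y₀}(B)χᶜ_{k,P}(B) ≤ exp(−½γ₂(ε₁²∕g_k²)|P| + ½γ₂‖PB‖²)» read in the unscaled field at the base point
`s₀ > 0`: for every `γ₂ ≥ 0`, every threshold letter `0 ≤ rP` with `rP·s₀ ≤ ε` (print: `rP = ε₁∕s₀`) and every `n ≤ |P|`,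
`χᵘ(s₀·B)·χᶜᵘ(s₀·B) ≤ exp(−½γ₂ rP² n + ½γ₂ Σ_{b∈P} B(b)²)` — the J17-D binder with `qP B := Σ_{b∈P} B(b)²` (node00-def-B13's `|Pl| = |P|` feeds `n := |P|`).
Per bond this is `B13.indicator_le_exp_222` (Chebyshev). [cite: Balaban1988RG2Cluster, (2.22) p.16; Balaban1987RG1, (2.9) p.266] -/
theorem chi_mul_chic_le_exp_222 (hχu : ∀ A, χu A = ∏ b ∈ Y₀, (if |A b| < ε then (1 : ℝ) else 0))
    (hχcu : ∀ A, χcu A = ∏ b ∈ P, (if ε ≤ |A b| then (1 : ℝ) else 0))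
    {s₀ γ₂ rP : ℝ} (hs : 0 < s₀) (hγ : 0 ≤ γ₂) (hrP : 0 ≤ rP) (hrPs : rP * s₀ ≤ ε) {n : ℕ} (hn : n ≤ P.card) (B : Λ → ℝ) :
    χu (s₀ • B) * χcu (s₀ • B) ≤ Real.exp (-(γ₂ / 2 * rP ^ 2 * (n : ℝ)) + γ₂ / 2 * ∑ b ∈ P, B b ^ 2) := by
  have hrle : rP ≤ ε / s₀ := (le_div_iff₀ hs).2 hrPs
  have hr' : 0 ≤ ε / s₀ := hrP.trans hrle
  -- the large-field function at `s₀ • B` is the product at threshold `ε / s₀`, bounded by the product form of (2.22)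
  have hL : χcu (s₀ • B) ≤ Real.exp (γ₂ / 2 * ∑ b ∈ P, B b ^ 2 - γ₂ / 2 * (ε / s₀) ^ 2 * (P.card : ℝ)) := by
    rw [hχcu, Finset.prod_congr rfl fun b _ => largeFactor_smul hs B b]
    exact prodLarge_le_exp_sum P hγ hr' B
  have hU1 : χu (s₀ • B) ≤ 1 := by rw [hχu]; exact prodBox_le_one Y₀ ε _
  have hL0 : 0 ≤ χcu (s₀ • B) := chic_smul_nonneg χcu P ε hχcu s₀ B
  have h1 : χu (s₀ • B) * χcu (s₀ • B) ≤ 1 * Real.exp (γ₂ / 2 * ∑ b ∈ P, B b ^ 2 - γ₂ / 2 * (ε / s₀) ^ 2 * (P.card : ℝ)) :=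
    mul_le_mul hU1 hL hL0 zero_le_one
  rw [one_mul] at h1
  refine h1.trans (Real.exp_le_exp.2 ?_)
  -- exponent comparison: `rP² n ≤ (ε/s₀)² |P|`
  have hsq : rP ^ 2 ≤ (ε / s₀) ^ 2 := pow_le_pow_left₀ hrP hrle 2
  have hnc : (n : ℝ) ≤ (P.card : ℝ) := by exact_mod_cast hn
  have hprod : rP ^ 2 * (n : ℝ) ≤ (ε / s₀) ^ 2 * (P.card : ℝ) := mul_le_mul hsq hnc (Nat.cast_nonneg n) (sq_nonneg _)
  have hγ2 : 0 ≤ γ₂ / 2 := by linarith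
  have := mul_le_mul_of_nonneg_left hprod hγ2
  linarith

/-- (2.22) at print's own letters `rP := ε ∕ s₀`, `n := |P|`. [cite: Balaban1988RG2Cluster, (2.22) p.16] -/
theorem chi_mul_chic_le_exp_222_print (hχu : ∀ A, χu A = ∏ b ∈ Y₀, (if |A b| < ε then (1 : ℝ) else 0))
    (hχcu : ∀ A, χcu A = ∏ b ∈ P, (if ε ≤ |A b| then (1 : ℝ) else 0))
    {s₀ γ₂ : ℝ} (hs : 0 < s₀) (hγ : 0 ≤ γ₂) (hε : 0 ≤ ε) (B : Λ → ℝ) :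
    χu (s₀ • B) * χcu (s₀ • B) ≤ Real.exp (-(γ₂ / 2 * (ε / s₀) ^ 2 * (P.card : ℝ)) + γ₂ / 2 * ∑ b ∈ P, B b ^ 2) :=
  chi_mul_chic_le_exp_222 χu χcu Y₀ P ε hχu hχcu hs hγ (div_nonneg hε hs.le) (by rw [div_mul_cancel₀ ε hs.ne']) le_rfl B

/-- `hχ1` at print's boxes, UNCONDITIONALLY (J17-D asks it on the small-field slices `P(t) = ∅` only): `χᵘ(s₀·B)·χᶜᵘ(s₀·B) ≤ 1`.
[cite: Balaban1987RG1, (2.9) p.266; Balaban1988RG2Cluster, (2.3) p.12] -/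
theorem chi_mul_chic_le_one (hχu : ∀ A, χu A = ∏ b ∈ Y₀, (if |A b| < ε then (1 : ℝ) else 0))
    (hχcu : ∀ A, χcu A = ∏ b ∈ P, (if ε ≤ |A b| then (1 : ℝ) else 0)) (s₀ : ℝ) (B : Λ → ℝ) :
    χu (s₀ • B) * χcu (s₀ • B) ≤ 1 := by
  have hU1 : χu (s₀ • B) ≤ 1 := by rw [hχu]; exact prodBox_le_one Y₀ ε _
  have hL1 : χcu (s₀ • B) ≤ 1 := by rw [hχcu]; exact prodLarge_le_one P ε _
  exact mul_le_one₀ hU1 (chic_smul_nonneg χcu P ε hχcu s₀ B) hL1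

/-- ★ **`hboxR` AT PRINT'S BOXES — THE BOX LAW**: on a slice WITHOUT large-field bonds (`P = ∅`), inside the ball `⟨B, B⟩ < Rb²` of any radius `0 ≤ Rb` with
`Rb·s₀ ≤ ε` (print: `Rb = ε₁∕s₀`) every bond of `Y₀` is small at `s₀·B`, so `χᵘ(s₀·B)·χᶜᵘ(s₀·B) = 1`. [cite: Balaban1987RG1, (2.9) p.266; Balaban1988RG2Cluster, (2.3) p.12] -/
theorem chi_mul_chic_eq_one_of_dotProduct_lt [Fintype Λ] (hχu : ∀ A, χu A = ∏ b ∈ Y₀, (if |A b| < ε then (1 : ℝ) else 0))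
    (hχcu : ∀ A, χcu A = ∏ b ∈ P, (if ε ≤ |A b| then (1 : ℝ) else 0)) (hP : P = ∅)
    {s₀ Rb : ℝ} (hs : 0 < s₀) (hRb : 0 ≤ Rb) (hRbs : Rb * s₀ ≤ ε) (B : Λ → ℝ) (hB : B ⬝ᵥ B < Rb ^ 2) :
    χu (s₀ • B) * χcu (s₀ • B) = 1 := by
  have hL : χcu (s₀ • B) = 1 := by rw [hχcu, hP, Finset.prod_empty]
  have hU : χu (s₀ • B) = 1 := by
    rw [hχu, prodBox_eq_one_iff]
    intro b _
    have hbb : B b * B b ≤ B ⬝ᵥ B := by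
      rw [dotProduct]
      exact Finset.single_le_sum (fun i _ => mul_self_nonneg (B i)) (Finset.mem_univ b)
    have hsq : (B b) ^ 2 < Rb ^ 2 := by rw [sq]; exact hbb.trans_lt hB
    have habs : |B b| < Rb := abs_lt_of_sq_lt_sq hsq hRb
    rw [Pi.smul_apply, smul_eq_mul, abs_mul, abs_of_pos hs]
    calc s₀ * |B b| < s₀ * Rb := mul_lt_mul_of_pos_left habs hs
      _ = Rb * s₀ := mul_comm _ _
      _ ≤ ε := hRbs
  rw [hU, hL, one_mul]

/-- `hbox` AT PRINT'S BOXES — THE s-FREE BOX-SUPPORT LAW (strict form): `χᵘ(A) ≠ 0 ⇒ |A(b)| < ε` for every bond `b ∈ Y₀`.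
[cite: Balaban1987RG1, (2.9) p.266] -/
theorem chi_ne_zero_support (hχu : ∀ A, χu A = ∏ b ∈ Y₀, (if |A b| < ε then (1 : ℝ) else 0)) (A : Λ → ℝ) (hA : χu A ≠ 0) :
    ∀ b ∈ Y₀, |A b| < ε := by
  rw [hχu] at hA
  rcases prodBox_eq_zero_or_one Y₀ ε A with h | h
  · exact absurd h hA
  · exact (prodBox_eq_one_iff Y₀ ε A).1 h

/-- `hbox` in J17-D's exact shape (`S₀ := ↑Y₀` as a set, any radius `ρ ≥ ε`): `χᵘ(A) ≠ 0 ⇒ ∀ b ∈ S₀, |A(b)| ≤ ρ`. [cite: Balaban1987RG1, (2.9) p.266] -/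
theorem chi_ne_zero_support_le (hχu : ∀ A, χu A = ∏ b ∈ Y₀, (if |A b| < ε then (1 : ℝ) else 0)) {ρ : ℝ} (hρ : ε ≤ ρ)
    (A : Λ → ℝ) (hA : χu A ≠ 0) : ∀ b ∈ (Y₀ : Set Λ), |A b| ≤ ρ :=
  fun b hb => ((chi_ne_zero_support χu Y₀ ε hχu A hA b (Finset.mem_coe.1 hb)).le).trans hρ

/-! ## §4 The junction with node00-def-B13's display (threshold `rP = ε₁ ∕ ‖g‖`) -/

/-- **THE UNSCALED READING IS node00-def-B13's DISPLAY**: at a base point `s₀ > 0`, `χᵘ(s₀·B) = Π_{b∈Y₀} χ(|B(b)| < ε∕s₀)` — `ResidB13K.chiY₀`'s shape at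
`rP = ε₁∕‖g‖` when `s₀ = ‖g‖`, `ε = ε₁` ([I] (2.12) «B = g_kB′»). [cite: Balaban1987RG1, (2.9) p.266 and (2.12) p.268; Balaban1988RG2Cluster, (2.3) p.12] -/
theorem chi_smul_eq_prod_threshold (hχu : ∀ A, χu A = ∏ b ∈ Y₀, (if |A b| < ε then (1 : ℝ) else 0)) {s₀ : ℝ} (hs : 0 < s₀)
    (B : Λ → ℝ) : χu (s₀ • B) = ∏ b ∈ Y₀, (if |B b| < ε / s₀ then (1 : ℝ) else 0) := by
  rw [hχu]
  exact Finset.prod_congr rfl fun b _ => boxFactor_smul hs B b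

/-- … and `χᶜᵘ(s₀·B) = Π_{b∈P} χ(ε∕s₀ ≤ |B(b)|)` — `ResidB13K.chicP`'s shape. [cite: Balaban1988RG2Cluster, (2.3) p.12] -/
theorem chic_smul_eq_prod_threshold (hχcu : ∀ A, χcu A = ∏ b ∈ P, (if ε ≤ |A b| then (1 : ℝ) else 0)) {s₀ : ℝ} (hs : 0 < s₀)
    (B : Λ → ℝ) : χcu (s₀ • B) = ∏ b ∈ P, (if ε / s₀ ≤ |B b| then (1 : ℝ) else 0) := by
  rw [hχcu]
  exact Finset.prod_congr rfl fun b _ => largeFactor_smul hs B b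

end Block

/-! ## §5 The box-tail letters UNIFORM in the base point at print's thresholds `Rb = rP = ε ∕ s₀` -/

/-- The one-variable fact behind the `s₀²`-gain of [I] (2.13) («the expression under the exponential above vanishes at g_k = 0»): for `c > 0` and
`s ≠ 0`, `exp(−c∕s²) ≤ s²∕(e·c)` (i.e. `y·e^{1−y} ≤ 1` at `y = c∕s²`). [folklore] -/
theorem exp_neg_div_sq_le {c : ℝ} (hc : 0 < c) {s : ℝ} (hs : s ≠ 0) :
    Real.exp (-(c / s ^ 2)) ≤ (Real.exp 1 * c)⁻¹ * s ^ 2 := by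
  have hs2 : 0 < s ^ 2 := by positivity
  have hpos : 0 < Real.exp 1 * c := by positivity
  have key : c / s ^ 2 * Real.exp (1 - c / s ^ 2) ≤ 1 := by
    have h1 : c / s ^ 2 ≤ Real.exp (c / s ^ 2 - 1) := by
      have := Real.add_one_le_exp (c / s ^ 2 - 1)
      linarith
    calc c / s ^ 2 * Real.exp (1 - c / s ^ 2) ≤ Real.exp (c / s ^ 2 - 1) * Real.exp (1 - c / s ^ 2) :=
          mul_le_mul_of_nonneg_right h1 (Real.exp_pos _).le
      _ = 1 := by rw [← Real.exp_add]; norm_num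
  have he : Real.exp (1 - c / s ^ 2) = Real.exp 1 * Real.exp (-(c / s ^ 2)) := by
    rw [← Real.exp_add]; ring_nf
  rw [he, div_mul_eq_mul_div, div_le_one hs2] at key
  have hmain : Real.exp (-(c / s ^ 2)) * (Real.exp 1 * c) ≤ s ^ 2 := by linarith
  calc Real.exp (-(c / s ^ 2)) = Real.exp (-(c / s ^ 2)) * (Real.exp 1 * c) * (Real.exp 1 * c)⁻¹ := by
        field_simp
    _ ≤ s ^ 2 * (Real.exp 1 * c)⁻¹ := mul_le_mul_of_nonneg_right hmain (inv_nonneg.2 hpos.le)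
    _ = (Real.exp 1 * c)⁻¹ * s ^ 2 := mul_comm _ _

/-- **`hRb` WITH A LETTER UNIFORM IN THE BASE POINT**: at print's box radius `Rb = ε∕s₀` the box-tail rate `e^{−½κRb²} ≤ T·s₀²` holds for EVERY `s₀ > 0` with the
ONE letter `T := (e·(½κε²))⁻¹` (`κ, ε > 0`) — the small-field slices' `T` can be chosen once on the whole window `]0, γ]`.
[cite: Balaban1987RG1, (2.9) p.266 and (2.13) p.268] -/
theorem boxTail_le_uniform {κ ε s₀ : ℝ} (hκ : 0 < κ) (hε : 0 < ε) (hs : 0 < s₀) :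
    Real.exp (-(κ / 2 * (ε / s₀) ^ 2)) ≤ (Real.exp 1 * (κ / 2 * ε ^ 2))⁻¹ * s₀ ^ 2 := by
  have h := exp_neg_div_sq_le (c := κ / 2 * ε ^ 2) (by positivity) hs.ne'
  have hre : κ / 2 * (ε / s₀) ^ 2 = κ / 2 * ε ^ 2 / s₀ ^ 2 := by rw [div_pow]; ring
  rw [hre]
  exact h

/-- **`hTP` WITH A LETTER UNIFORM IN THE BASE POINT**: at print's threshold `rP = ε∕s₀` the (2.22)-surplus rate `e^{−½γ₂(rP² − r₁²)} ≤ TP·s₀²` holds for EVERY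
`s₀ > 0` with the ONE letter `TP := e^{½γ₂r₁²}·(e·(½γ₂ε²))⁻¹` (`γ₂, ε > 0`). [cite: Balaban1988RG2Cluster, (2.22) p.16; Balaban1987RG1, (2.13) p.268] -/
theorem surplusTail_le_uniform {γ₂ ε s₀ : ℝ} (r₁ : ℝ) (hγ : 0 < γ₂) (hε : 0 < ε) (hs : 0 < s₀) :
    Real.exp (-(γ₂ / 2 * ((ε / s₀) ^ 2 - r₁ ^ 2))) ≤
      (Real.exp (γ₂ / 2 * r₁ ^ 2) * (Real.exp 1 * (γ₂ / 2 * ε ^ 2))⁻¹) * s₀ ^ 2 := by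
  have h := exp_neg_div_sq_le (c := γ₂ / 2 * ε ^ 2) (by positivity) hs.ne'
  have hsplit : Real.exp (-(γ₂ / 2 * ((ε / s₀) ^ 2 - r₁ ^ 2))) =
      Real.exp (γ₂ / 2 * r₁ ^ 2) * Real.exp (-(γ₂ / 2 * ε ^ 2 / s₀ ^ 2)) := by
    rw [← Real.exp_add]
    congr 1
    rw [div_pow]
    ring
  rw [hsplit, mul_assoc]
  exact mul_le_mul_of_nonneg_left h (Real.exp_pos _).le

end Summit.QuantumFields.YangMills.BalabanUVNodes.N22PrintedBoxBlock
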